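import Mathlib
import Summits.Ventures.PercRepro2.SwOutAll
import Summits.Ventures.PercRepro2.SwOutReducible
import Summits.Ventures.PercRepro2.SwOutAdjThm
import Summits.Ventures.PercRepro2.SwOutAdjIndDefs
import Summits.Ventures.PercRepro2.SwOutAdjInd

/-!
# An instance of the region induction with a junction set (blind cell PercRepro2, night-4 g11,
2026-08-25; proofs/NIGHT4-G11.md §5(5))

Row (SW) on `K₄` on `{h, u₁, u₂, o}` with the two paths `h − a₁ − u₁`, `h − a₂ − u₂` and the apex
`l` joined to `o` (`sw_theta_plus2`): the path vertices `a₁, a₂` are series-reduced and the two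
ADJACENT junctions `u₁, u₂` (four edges each, none to `l`) are the base of the adjacent-junction
theorem.
-/

namespace Summit.Ventures.PercRepro2

namespace LocRows

open Hull

open scoped Classical

/-- The graph on `Fin 7`: `l = 0`, `h = 1`, the junctions `u₁ = 2`, `u₂ = 3`, `o = 4`, the path
vertices `a₁ = 5`, `a₂ = 6`; `K₄` on `{1, 2, 3, 4}`, the paths `1 − 5 − 2` and `1 − 6 − 3`, and `0`
joined to `4`. -/
def thetaPlus2 : Fin 11 → Sym2 (Fin 7)
  | 0 => s(0, 4) | 1 => s(1, 2) | 2 => s(1, 3) | 3 => s(1, 4) | 4 => s(2, 3) | 5 => s(2, 4)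
  | 6 => s(3, 4) | 7 => s(1, 5) | 8 => s(5, 2) | 9 => s(1, 6) | 10 => s(6, 3)

/-- **Row (SW) on `thetaPlus2`** with `l = 0`, `h = 1`, `o = 4` and the adjacent junctions
`2, 3`: the series reductions at `5, 6` and the adjacent-junction theorem together. -/
theorem sw_theta_plus2 : Sw thetaPlus2 0 1 4 := by
  have hw : ∀ p : Fin 7, p ≠ 0 → p ≠ 1 → ∃ e', thetaPlus2 e' = s(p, 1) := by
    intro p hp0 hp1
    fin_cases p
    · exact absurd rfl hp0
    · exact absurd rfl hp1
    · exact ⟨1, by rw [Sym2.eq_swap]; rfl⟩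
    · exact ⟨2, by rw [Sym2.eq_swap]; rfl⟩
    · exact ⟨3, by rw [Sym2.eq_swap]; rfl⟩
    · exact ⟨7, by rw [Sym2.eq_swap]; rfl⟩
    · exact ⟨9, by rw [Sym2.eq_swap]; rfl⟩
  refine sw_of_adjJunctionRegion (l := 0) (h := 1) (o := 4) (J := {2, 3}) (by decide) (by simp)
    (by simp) thetaPlus2 ?_ ?_
  · intro x hx hx1 hx4 hxJ
    fin_cases x
    · simp at hx
    · exact absurd rfl hx1
    · exact absurd (by simp) hxJ
    · exact absurd (by simp) hxJ
    · exact absurd rfl hx4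
    · -- the path vertex `5`
      right
      refine ⟨?_, ?_⟩
      · intro e he y hy
        fin_cases e <;> simp [thetaPlus2] at he hy ⊢ <;> omega
      · have h58 : edgesAt thetaPlus2 5 = {7, 8} := by
          ext e
          rw [mem_edgesAt, Finset.mem_insert, Finset.mem_singleton]
          fin_cases e <;> simp [thetaPlus2]
        show (edgesAt thetaPlus2 5).card ≤ 2
        rw [h58]
        decide
    · -- the path vertex `6`
      right
      refine ⟨?_, ?_⟩
      · intro e he y hy
        fin_cases e <;> simp [thetaPlus2] at he hy ⊢ <;> omega
      · have h69 : edgesAt thetaPlus2 6 = {9, 10} := by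
          ext e
          rw [mem_edgesAt, Finset.mem_insert, Finset.mem_singleton]
          fin_cases e <;> simp [thetaPlus2]
        show (edgesAt thetaPlus2 6).card ≤ 2
        rw [h69]
        decide
  · intro u hu e p hep hph
    simp only [Set.mem_insert_iff, Set.mem_singleton_iff] at hu
    rcases hu with rfl | rfl <;> fin_cases e <;> simp only [thetaPlus2] at hep <;>
      rw [Sym2.eq_iff] at hep <;> rcases hep with ⟨h1, h2⟩ | ⟨h1, h2⟩ <;>
      first
      | exact absurd h1 (by decide)
      | exact absurd h2 (by decide)
      | (subst h2; first | exact absurd rfl hph | exact hw _ (by decide) hph)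
      | (subst h1; first | exact absurd rfl hph | exact hw _ (by decide) hph)

end LocRows

end Summit.Ventures.PercRepro2
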